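import Summits.QuantumFields.BalabanUV.Beta.GAN24.DirichletExhaustionCoerZ
import Summits.QuantumFields.BalabanUV.Beta.GAN24.DirichletExhaustionQuadForm
import Summits.QuantumFields.BalabanUV.Beta.GAN24.DirichletExhaustionAssembly

/-!
# `BalabanUV.Beta.GAN24.DirichletExhaustionCoer` — binder row G-an2-4 / (CONV-C), part P2, PART 18 = skeleton node S4.b + THE END: (2.157) ON
# `ℤ^{d+1}` IN PADDED FORM, `Coer2157Z d L (gamma2153 (d+1) L)` PROVED, hence PART 15's T (= O-an2-2a, the `U = 1` covariance constituent of
# (CONV-C) for Bałaban's `C^{(k)}(𝟙) = C·(CᵀΔ_kC)⁻¹·Cᵀ` on ℤ^{d+1}, `θ = L⁻²`) UNCONDITIONAL — `convC_balaban`, `decayCauchy_balaban`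
# (unit b2b-balaban-gan24-p2, gen 2, v1)

HONEST FRAMING (cell contract, verbatim): «discharging `BetaPertH` makes Bałaban's UV stability UNCONDITIONAL — a real constructive-QFT
result; it is NOT the continuum limit and NOT the Clay problem.»  Skeleton `HOME/b2b-balaban-gan24-p2/gen1/SKELETON-P2.md`: the image `w = Cv`
of PART 11's elimination `elimZ L` satisfies the `ℤ^{d+1}` constraints — tree rows vanish, and the columns of `C` are annihilated by the
multiplicity functional of every coarse bond (`Q(CB′) = 0`: the pivot `b₀(c)` has multiplicity `L` and pivots are private, b06-g3's `mult_pivSite` /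
`cOf_eq_of_mult_ne_zero`) — so PART 17's `lower2153_Z` and PART 14's `hcoer_of_lower` give PART 15's one remaining shape `Coer2157Z` with
`γ = gamma2153 (d+1) L = (γ₀/12(d+1)²)L^{−(d+2)}` ([Balaban1984PropagatorsII] (2.157): «⟨B′, C*Δ_kCB′⟩ ≥ (γ₀/12d²)L^{−d−1}‖CB′‖² ≥ γ′₀‖B′‖²»,
there in dimension `d`; here `d+1`).  WHAT THIS CLOSES: T of the skeleton — (CONV-C) for the covariance constituent `C^{(k)}(𝟙)` as typed on
ℤ^{d+1} (PARTS 8/11, padded socket PART 10), θ = L⁻², all constants explicit in `(d, L)`.  WHAT IT DOES NOT: the K-slot of row G-an2-4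
(`KInvStep`; dictionary S6 with an2/gan24-p1), `BetaPertH`, continuum, Clay.  «not in print; our proof attempt».

ABSOLUTE RULE (cell, verbatim): «No internally-minted statement may enter as a cited fact. Every hypothesis is either kernel-proved in this
package or a verbatim quotation of a PUBLISHED theorem with page reference. The manuscript(s) under audit are NOT citable for their own disputed
steps — they are the thing under adjudication; programme-internal (2001/route/tribunal) claims are never citable.»

WHAT IS PROVED (0 sorry): `elimZ_tree_row`, `isPivZ_pivSite`, `not_isTreeZ_pivSite`, **`sum_mult_elimZ`** (`Q(CB′) = 0` on ℤ^{d+1}), `exists_rowSet`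
(a finite row set carrying every column over a region), `amb_injective`, `gamma2153_le_one`,
**`coer2157Z`** (S4.b: `Coer2157Z d L (gamma2153 (d+1) L)` for `d ≥ 1`, `L ≥ 1`), **`convC_balaban`** (T unconditional), **`decayCauchy_balaban`**
(T in the wall's currency, `L ≥ 2`).  NOT summit progress.
-/

namespace Summit.QuantumFields.BalabanUV.Beta.GAN24.DirichletExhaustionCoer

open Finset Real
open Literature.MathematicalPhysics.QuantumFieldTheory.Balaban1983to89
open B4Sect5Proof (cStar deltaStar cStar_pos deltaStar_pos)
open B6BondElimination (pivSite cOf pivSite_apply cOf_pivSite pivSite_cOf eq_of_cOf_eq mult mult_pivSite cOf_eq_of_mult_ne_zero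
  corner_pivSite)
open B6Cov2156Torus (gamma2153 gamma2153_pos)
open B4Sect5Exhaustion (K toMat)
open Summit.QuantumFields.BalabanUV.Beta.GAN24.DirichletExhaustion
open Summit.QuantumFields.BalabanUV.Beta.GAN24.DirichletExhaustionFamily
open Summit.QuantumFields.BalabanUV.Beta.GAN24.DirichletExhaustionSandwich
open Summit.QuantumFields.BalabanUV.Beta.GAN24.DirichletExhaustionCovariance
open Summit.QuantumFields.BalabanUV.Beta.GAN24.DirichletExhaustionCovariancePad
open Summit.QuantumFields.BalabanUV.Beta.GAN24.DirichletExhaustionDeltaZ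
open Summit.QuantumFields.BalabanUV.Beta.GAN24.DirichletExhaustionElimZ
open Summit.QuantumFields.BalabanUV.Beta.GAN24.DirichletExhaustionDecays (toMKer)
open Summit.QuantumFields.BalabanUV.Beta.GAN24.DirichletExhaustionQuadForm (amb hcoer_of_lower)
open Summit.QuantumFields.BalabanUV.Beta.GAN24.DirichletExhaustionAssembly (Coer2157Z convC_balaban_of_coer decayCauchy_balaban_of_coer)
open Summit.QuantumFields.BalabanUV.Beta.GAN24.DirichletExhaustionCoerZ (lower2153_Z)
open Summit.QuantumFields.BalabanUV.Beta.GAN24.CombesThomas (DecayCauchy)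

noncomputable section

variable {d : ℕ}

/-! ## §1 The `ℤ^{d+1}` constraints of the elimination image `Cv` -/

/-- **Tree rows of `C` vanish**: `(CB′)(Γ_{y,x}) = 0` on ℤ^{d+1}. -/
theorem elimZ_tree_row {L : ℕ} {r : K (d + 1) (d + 1)} (hr : IsTreeZ L r) (f : K (d + 1) (d + 1)) : elimZ L r f = 0 := by
  unfold elimZ
  split_ifs with hf hrf h
  · exact absurd (hrf ▸ hr) hf.1
  · rfl
  · exact absurd (Or.inl hr) h
  · rfl

/-- The last unit bond of a coarse bond `c`, `c₋ ∈ Lℤ^{d+1}`, is a pivot. -/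
theorem isPivZ_pivSite {L : ℕ} (c : (Fin (d + 1) → ℤ) × Fin (d + 1)) (hc : ∀ i, (L : ℤ) ∣ c.1 i) :
    IsPivZ L (pivSite L c, c.2) := by
  intro i
  dsimp only
  rw [cOf_pivSite]
  exact hc i

/-- A pivot is never a tree bond (it is the LAST unit bond of `c` inside `B(c₋)`). -/
theorem not_isTreeZ_pivSite {L : ℕ} (hL : 0 < L) {c : (Fin (d + 1) → ℤ) × Fin (d + 1)} (hc : ∀ i, (L : ℤ) ∣ c.1 i) :
    ¬ IsTreeZ L (pivSite L c, c.2) := by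
  rintro ⟨h, -⟩
  dsimp only at h
  rw [corner_pivSite hL hc, pivSite_apply, if_pos rfl] at h
  omega

/-- **`Q(CB′) = 0` ON ℤ^{d+1}** ([Balaban1984PropagatorsII] p. 250 «By the definition of C we have of course that … QCB′ = 0 … for arbitrary B′»):
the column `f` of `elimZ L` is annihilated by the multiplicity functional `r ↦ mult_c(r)` of EVERY coarse bond `c`, `c₋ ∈ Lℤ^{d+1}`, summed over any
finite set of rows containing the column's support (the free row `f` contributes `mult_c(f)`, the pivot row `b₀(c)` contributes `L·(−mult_c(f)/L)`,
every other pivot row `b₀(c′)`, `c′ ≠ c`, has `mult_c(b₀(c′)) = 0` — pivots are private). -/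
theorem sum_mult_elimZ {L : ℕ} (hL : 0 < L) {c : (Fin (d + 1) → ℤ) × Fin (d + 1)} (hc : ∀ i, (L : ℤ) ∣ c.1 i)
    (f : K (d + 1) (d + 1)) (S : Finset (K (d + 1) (d + 1))) (hS : ∀ r, elimZ L r f ≠ 0 → r ∈ S) :
    ∑ r ∈ S, (mult L c r.1 r.2 : ℝ) * elimZ L r f = 0 := by
  classical
  by_cases hf : IsFreeZ L f
  swap
  · exact Finset.sum_eq_zero fun r _ => by rw [elimZ_of_not_free hf, mul_zero]
  obtain ⟨P, hP⟩ : ∃ P : K (d + 1) (d + 1), P = (pivSite L c, c.2) := ⟨_, rfl⟩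
  have hPpiv : IsPivZ L P := hP ▸ isPivZ_pivSite c hc
  have hPtree : ¬ IsTreeZ L P := hP ▸ not_isTreeZ_pivSite hL hc
  have hPf : P ≠ f := fun h => hf.2 (h ▸ hPpiv)
  have hcOfP : cOf L P.1 P.2 = c := by rw [hP]; exact cOf_pivSite c
  have hmultP : mult L c P.1 P.2 = L := by rw [hP]; exact mult_pivSite hL c
  -- the pivot row entry
  have hPval : elimZ L P f = -((mult L c f.1 f.2 : ℝ) / L) := by
    unfold elimZ
    rw [if_pos hf, if_neg hPf, if_neg (fun h => h.elim hPtree (fun h' => h' hPpiv)), hcOfP]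
  -- every row other than `f` and `P` contributes zero
  have hzero : ∀ r, r ≠ f → r ≠ P → (mult L c r.1 r.2 : ℝ) * elimZ L r f = 0 := by
    intro r hrf hrP
    unfold elimZ
    rw [if_pos hf, if_neg hrf]
    split_ifs with h
    · rw [mul_zero]
    · rw [not_or, not_not] at h
      by_cases hm : mult L c r.1 r.2 = 0
      · rw [hm, Nat.cast_zero, zero_mul]
      · exfalso
        have e := cOf_eq_of_mult_ne_zero hL hc h.2 hm
        obtain ⟨e1, e2⟩ := eq_of_cOf_eq e
        exact hrP (by rw [hP]; exact Prod.ext e1 e2)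
  by_cases hm : mult L c f.1 f.2 = 0
  · refine Finset.sum_eq_zero fun r _ => ?_
    by_cases hrf : r = f
    · rw [hrf, hm, Nat.cast_zero, zero_mul]
    by_cases hrP : r = P
    · rw [hrP, hPval, hm, Nat.cast_zero, zero_div, neg_zero, mul_zero]
    exact hzero r hrf hrP
  · have hfS : f ∈ S := hS f (by rw [elimZ_free_row hf, if_pos rfl]; exact one_ne_zero)
    have hPS : P ∈ S := hS P (by
      rw [hPval, neg_ne_zero]
      have hL' : (0 : ℝ) < L := by exact_mod_cast hL
      have hm' : (0 : ℝ) < mult L c f.1 f.2 := by exact_mod_cast Nat.pos_of_ne_zero hm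
      positivity)
    rw [← Finset.add_sum_erase S _ hfS, ← Finset.add_sum_erase (S.erase f) _ (Finset.mem_erase.2 ⟨hPf, hPS⟩)]
    have hrest : ∑ r ∈ (S.erase f).erase P, (mult L c r.1 r.2 : ℝ) * elimZ L r f = 0 :=
      Finset.sum_eq_zero fun r hr => by
        obtain ⟨hrP, hr'⟩ := Finset.mem_erase.1 hr
        exact hzero r (Finset.mem_erase.1 hr').1 hrP
    rw [hrest, add_zero, elimZ_free_row hf, if_pos rfl, mul_one, hPval, hmultP]
    have hL' : (L : ℝ) ≠ 0 := by exact_mod_cast hL.ne'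
    field_simp
    ring

/-! ## §2 The finite row support of the columns over a region -/

/-- **A finite row set carrying every column over the region**: there is a finite `R` containing every bond within sup-distance `L − 1` of a
point of `Λ` (all directions) — hence (PART 11's finite range `elimZ_eq_zero_of_dist`) every row `r` with `elimZ L r (amb p) ≠ 0`, `p ∈ Λ × Fin (d+1)`. -/
theorem exists_rowSet (L : ℕ) (hL : 0 < L) (Λ : Finset (Fin (d + 1) → ℤ)) :
    ∃ R : Finset (K (d + 1) (d + 1)),
      (∀ (r : K (d + 1) (d + 1)) (x : Fin (d + 1) → ℤ), x ∈ Λ → dist r.1 x ≤ (L : ℝ) - 1 → r ∈ R) ∧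
      (∀ (r : K (d + 1) (d + 1)) (p : B4.Idx Λ (d + 1)), elimZ L r (amb p) ≠ 0 → r ∈ R) := by
  classical
  refine ⟨(Λ.biUnion fun x => Fintype.piFinset fun i => Finset.Icc (x i - ((L : ℤ) - 1)) (x i + ((L : ℤ) - 1))) ×ˢ Finset.univ, ?_, ?_⟩
  · intro r x hx h
    rw [Finset.mem_product]
    refine ⟨Finset.mem_biUnion.2 ⟨x, hx, Fintype.mem_piFinset.2 fun i => Finset.mem_Icc.2 ?_⟩, Finset.mem_univ _⟩
    have hi : |((r.1 i : ℤ) : ℝ) - (x i : ℝ)| ≤ (L : ℝ) - 1 := by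
      rw [← Int.dist_eq]; exact (dist_le_pi_dist r.1 x i).trans h
    rw [abs_le] at hi
    obtain ⟨h1, h2⟩ := hi
    have e1 : (((x i - ((L : ℤ) - 1) : ℤ)) : ℝ) ≤ ((r.1 i : ℤ) : ℝ) := by push_cast; linarith
    have e2 : ((r.1 i : ℤ) : ℝ) ≤ (((x i + ((L : ℤ) - 1) : ℤ)) : ℝ) := by push_cast; linarith
    exact ⟨by exact_mod_cast e1, by exact_mod_cast e2⟩
  · intro r p h
    rw [Finset.mem_product]
    by_contra hne
    apply h
    apply elimZ_eq_zero_of_dist hL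
    by_contra hlt
    push Not at hlt
    apply hne
    have hmem : r ∈ (Λ.biUnion fun x => Fintype.piFinset fun i => Finset.Icc (x i - ((L : ℤ) - 1)) (x i + ((L : ℤ) - 1))) ×ˢ
        (Finset.univ : Finset (Fin (d + 1))) := by
      rw [Finset.mem_product]
      refine ⟨Finset.mem_biUnion.2 ⟨(p.1 : Fin (d + 1) → ℤ), p.1.2, Fintype.mem_piFinset.2 fun i => Finset.mem_Icc.2 ?_⟩,
        Finset.mem_univ _⟩
      have hi : |((r.1 i : ℤ) : ℝ) - ((p.1 : Fin (d + 1) → ℤ) i : ℝ)| ≤ (L : ℝ) - 1 := by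
        rw [← Int.dist_eq]; exact (dist_le_pi_dist r.1 (p.1 : Fin (d + 1) → ℤ) i).trans hlt
      rw [abs_le] at hi
      obtain ⟨h1, h2⟩ := hi
      have e1 : ((((p.1 : Fin (d + 1) → ℤ) i - ((L : ℤ) - 1) : ℤ)) : ℝ) ≤ ((r.1 i : ℤ) : ℝ) := by push_cast; linarith
      have e2 : ((r.1 i : ℤ) : ℝ) ≤ ((((p.1 : Fin (d + 1) → ℤ) i + ((L : ℤ) - 1) : ℤ)) : ℝ) := by push_cast; linarith
      exact ⟨by exact_mod_cast e1, by exact_mod_cast e2⟩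
    exact Finset.mem_product.1 hmem

/-- `amb` is injective. -/
theorem amb_injective {Λ : Finset (Fin (d + 1) → ℤ)} : Function.Injective (amb (Λ := Λ) (N := d + 1)) := fun p q h => by
  obtain ⟨h1, h2⟩ := Prod.ext_iff.1 h
  exact Prod.ext (Subtype.ext h1) h2

/-! ## §3 The constant -/

/-- `gamma2153 n L ≤ 1` (`4/π² ≤ 1`, `12n² ≥ 1` or `n = 0`, `L^{−(n+1)} ≤ 1` for `L ≥ 1`). -/
theorem gamma2153_le_one (n L : ℕ) (hL : 1 ≤ L) : gamma2153 n L ≤ 1 := by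
  unfold gamma2153
  have hπ : (4 : ℝ) / Real.pi ^ 2 ≤ 1 := by
    rw [div_le_one (by positivity)]
    nlinarith [Real.pi_gt_three]
  have h1 : ((4 : ℝ) / Real.pi ^ 2) ^ (n + 2) ≤ 1 := pow_le_one₀ (by positivity) hπ
  have h2 : ((4 : ℝ) / Real.pi ^ 2) ^ (n + 2) / (12 * (n : ℝ) ^ 2) ≤ 1 := by
    rcases Nat.eq_zero_or_pos n with hn | hn
    · subst hn; simp
    · have h12 : (1 : ℝ) ≤ 12 * (n : ℝ) ^ 2 := by
        have : (1 : ℝ) ≤ n := by exact_mod_cast hn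
        nlinarith
      exact (div_le_one (by positivity)).2 (h1.trans h12)
  have h3 : (L : ℝ) ^ (-((n : ℝ) + 1)) ≤ 1 :=
    Real.rpow_le_one_of_one_le_of_nonpos (by exact_mod_cast hL) (by have : (0 : ℝ) ≤ n := Nat.cast_nonneg n; linarith)
  calc ((4 : ℝ) / Real.pi ^ 2) ^ (n + 2) / (12 * (n : ℝ) ^ 2) * (L : ℝ) ^ (-((n : ℝ) + 1)) ≤ 1 * 1 :=
        mul_le_mul h2 h3 (by positivity) zero_le_one
    _ = 1 := one_mul 1

/-! ## §4 (2.157) on `ℤ^{d+1}` in padded form (S4.b) -/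

/-- **S4.b — `Coer2157Z d L (gamma2153 (d+1) L)` PROVED** (`d ≥ 1`, `L ≥ 1`): for every `k`, every finite region `Λ` and every `v`,
`γ′₀·Σ v² ≤ ⟨v, (pad(CᵀΔ_kC))_Λ v⟩` with `(C, Δ_k, Free) = (elimZ L, deltaZ L k, IsFreeZ L)` and `γ′₀ = gamma2153 (d+1) L` — PART 14's reduction
`hcoer_of_lower` fed with PART 17's `lower2153_Z` for the image `w = Cv` (its ℤ^{d+1} constraints by §1) and the copy rows of the free bonds. -/
theorem coer2157Z (hd : 1 ≤ d) (L : ℕ) [NeZero L] : Coer2157Z d L (gamma2153 (d + 1) L) := by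
  intro k Λ v
  classical
  have hL : 0 < L := Nat.pos_of_ne_zero (NeZero.ne L)
  -- the image `w = Cv`, supported in a finite row set `R`
  obtain ⟨R, hRdist, hRcol⟩ := exists_rowSet L hL Λ
  have hsupp : ∀ r, r ∉ R → (∑ p : B4.Idx Λ (d + 1), elimZ L r (amb p) * v p) = 0 := by
    intro r hr
    refine Finset.sum_eq_zero fun p _ => ?_
    have h0 : elimZ L r (amb p) = 0 := by
      by_contra h
      exact hr (hRcol r p h)
    rw [h0, zero_mul]
  have htree : ∀ r, IsTreeZ L r → (∑ p : B4.Idx Λ (d + 1), elimZ L r (amb p) * v p) = 0 := fun r hr =>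
    Finset.sum_eq_zero fun p _ => by rw [elimZ_tree_row hr, zero_mul]
  have havg : ∀ c : (Fin (d + 1) → ℤ) × Fin (d + 1), (∀ i, (L : ℤ) ∣ c.1 i) →
      ∑ r ∈ R, (mult L c r.1 r.2 : ℝ) * (∑ p : B4.Idx Λ (d + 1), elimZ L r (amb p) * v p) = 0 := by
    intro c hc
    calc ∑ r ∈ R, (mult L c r.1 r.2 : ℝ) * (∑ p : B4.Idx Λ (d + 1), elimZ L r (amb p) * v p)
        = ∑ p : B4.Idx Λ (d + 1), v p * ∑ r ∈ R, (mult L c r.1 r.2 : ℝ) * elimZ L r (amb p) := by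
          simp only [Finset.mul_sum]
          rw [Finset.sum_comm]
          refine Finset.sum_congr rfl fun p _ => Finset.sum_congr rfl fun r _ => ?_
          ring
      _ = 0 := Finset.sum_eq_zero fun p _ => by
          rw [sum_mult_elimZ hL hc (amb p) (R) (fun r hr => hRcol r p hr), mul_zero]
  have hlow := lower2153_Z hd L k (R) (fun r => ∑ p : B4.Idx Λ (d + 1), elimZ L r (amb p) * v p) hsupp htree havg
  have hγ1 : gamma2153 (d + 1) L ≤ 1 := gamma2153_le_one (d + 1) L hL
  have hγ0 : 0 ≤ gamma2153 (d + 1) L := (gamma2153_pos (by omega) hL).le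
  refine hcoer_of_lower (IsFreeZ L) (elimZ L) (deltaZ L k) (R) (fun r p hp => elimZ_of_not_free hp)
    (fun r p h => hRcol r p h) hγ0 hγ1 v hlow ?_
  -- the free rows copy: `Σ_{p free} v_p² ≤ Σ_{r ∈ R} w_r²`
  have hcopy : ∀ p : B4.Idx Λ (d + 1), IsFreeZ L (amb p) → (∑ q : B4.Idx Λ (d + 1), elimZ L (amb p) (amb q) * v q) = v p := by
    intro p hp
    rw [Finset.sum_eq_single p]
    · rw [elimZ_free_row hp, if_pos rfl, one_mul]
    · intro q _ hqp
      rw [elimZ_free_row hp, if_neg (fun h => hqp (amb_injective h).symm), zero_mul]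
    · intro h
      exact absurd (Finset.mem_univ p) h
  let e : B4.Idx Λ (d + 1) ↪ K (d + 1) (d + 1) := ⟨amb, amb_injective⟩
  have hsub : Finset.univ.map e ⊆ R := by
    intro r hr
    obtain ⟨p, _, hp⟩ := Finset.mem_map.1 hr
    rw [← hp]
    refine hRdist _ _ p.1.2 ?_
    change dist (p.1 : Fin (d + 1) → ℤ) (p.1 : Fin (d + 1) → ℤ) ≤ (L : ℝ) - 1
    rw [dist_self]
    have : (1 : ℝ) ≤ L := by exact_mod_cast hL
    linarith
  calc ∑ p : B4.Idx Λ (d + 1), (if IsFreeZ L (amb p) then v p ^ 2 else 0)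
      = ∑ p : B4.Idx Λ (d + 1), (if IsFreeZ L (amb p) then (∑ q : B4.Idx Λ (d + 1), elimZ L (amb p) (amb q) * v q) ^ 2 else 0) :=
        Finset.sum_congr rfl fun p _ => by
          split_ifs with hp
          · rw [hcopy p hp]
          · rfl
    _ = ∑ r ∈ Finset.univ.map e, (if IsFreeZ L r then (∑ q : B4.Idx Λ (d + 1), elimZ L r (amb q) * v q) ^ 2 else 0) := by
        rw [Finset.sum_map]
        rfl
    _ ≤ ∑ r ∈ R, (if IsFreeZ L r then (∑ q : B4.Idx Λ (d + 1), elimZ L r (amb q) * v q) ^ 2 else 0) :=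
        Finset.sum_le_sum_of_subset_of_nonneg hsub fun r _ _ => by split_ifs <;> positivity
    _ ≤ ∑ r ∈ R, (∑ q : B4.Idx Λ (d + 1), elimZ L r (amb q) * v q) ^ 2 :=
        Finset.sum_le_sum fun r _ => by
          split_ifs
          · exact le_rfl
          · positivity

/-! ## §5 THE END: T unconditional -/

/-- **T OF THE SKELETON, UNCONDITIONAL** (`d ≥ 1`, `L ≥ 1`): for Bałaban's typed objects on ℤ^{d+1} — the elimination `C = elimZ L` (PART 11), the
`U = 1` action kernels `Δ_k = deltaZ L k` (PART 8), free bonds `IsFreeZ L` — the padded (2.156)-shaped covariance family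
`k ↦ C·(pad(CᵀΔ_kC))_Λ⁻¹·Cᵀ` satisfies (CONV-C) (`ConvC`: k-uniform exponential decay AND the one-step rate `θ^k`, `θ = L⁻²`) on EVERY
`Λ ⊆ ℤ^{d+1}`, with PART 10's displayed constants at `(c_C, c₀, δ, γ, θ₀) = (e^{κZ(L−1)}, c166Z d, κZ d, gamma2153 (d+1) L, θ166Z d)`.
PART 15's `convC_balaban_of_coer` with `Coer2157Z` DISCHARGED by `coer2157Z`.  NOT the K-slot of (CONV-C); NOT `BetaPertH`, NOT continuum, NOT Clay. -/
theorem convC_balaban (hd : 1 ≤ d) (L : ℕ) [NeZero L] (Λ : Set (Fin (d + 1) → ℤ)) :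
    ConvC (covPad (elimZ L) (deltaZ L) (IsFreeZ L) Λ)
      (sandwichConst (d + 1) (d + 1) (Real.exp (kappaZ d * ((L : ℝ) - 1)))
          (deltaStar (d + 1) (d + 1) (gamma2153 (d + 1) L)
            (max (sandwichConst (d + 1) (d + 1) (Real.exp (kappaZ d * ((L : ℝ) - 1))) (kappaZ d) * c166Z d) 1) (kappaZ d / 2)) *
        convConst (d + 1) (d + 1) (gamma2153 (d + 1) L)
          (max (sandwichConst (d + 1) (d + 1) (Real.exp (kappaZ d * ((L : ℝ) - 1))) (kappaZ d) * c166Z d) 1) (kappaZ d / 2)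
          (sandwichConst (d + 1) (d + 1) (Real.exp (kappaZ d * ((L : ℝ) - 1))) (kappaZ d) * theta166Z d))
      (deltaStar (d + 1) (d + 1) (gamma2153 (d + 1) L)
          (max (sandwichConst (d + 1) (d + 1) (Real.exp (kappaZ d * ((L : ℝ) - 1))) (kappaZ d) * c166Z d) 1) (kappaZ d / 2) / 2)
      (((L : ℝ) ^ 2)⁻¹) :=
  convC_balaban_of_coer L (gamma2153_pos (by omega) (Nat.pos_of_ne_zero (NeZero.ne L))) (coer2157Z hd L) Λ

/-- **T IN THE WALL'S CURRENCY, UNCONDITIONAL** (`d ≥ 1`, `L ≥ 2`, so `θ = L⁻² < 1`): explicit `C₄ ≥ 0`, `δ₄ > 0` with `ConvC … C₄ δ₄ L⁻²` and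
`DecayCauchy (k ↦ toMKer (covPad (elimZ L) (deltaZ L) (IsFreeZ L) Λ k)) (C₄/(1−L⁻²)) L⁻² (δ₄/(d+1))` — PART 15's `decayCauchy_balaban_of_coer`
with `Coer2157Z` DISCHARGED.  NOT the K-slot of (CONV-C); NOT `BetaPertH`, NOT continuum, NOT Clay. -/
theorem decayCauchy_balaban (hd : 1 ≤ d) (L : ℕ) [NeZero L] (hL : 2 ≤ L) (Λ : Set (Fin (d + 1) → ℤ)) :
    ∃ C₄ δ₄ : ℝ, 0 ≤ C₄ ∧ 0 < δ₄ ∧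
      ConvC (covPad (elimZ L) (deltaZ L) (IsFreeZ L) Λ) C₄ δ₄ (((L : ℝ) ^ 2)⁻¹) ∧
      DecayCauchy (fun k => toMKer (covPad (elimZ L) (deltaZ L) (IsFreeZ L) Λ k)) (C₄ / (1 - ((L : ℝ) ^ 2)⁻¹)) (((L : ℝ) ^ 2)⁻¹)
        (δ₄ / ((d + 1 : ℕ) : ℝ)) :=
  decayCauchy_balaban_of_coer L hL (gamma2153_pos (by omega) (Nat.pos_of_ne_zero (NeZero.ne L))) (coer2157Z hd L) Λ

end

end Summit.QuantumFields.BalabanUV.Beta.GAN24.DirichletExhaustionCoer
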